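/-
NEW (pub-hodgecm2, COR-CM cell = stage 2 of the Hodge ladder; binder prover b10, row P7 of `HOME/BINDER-OWNERS.md`, part 1/2).
Not a port: the 28-field record `ModelAxioms` (`CorCM/Geometry/Facts.lean`) of the Picard–CM model universe
`Model.universeOf hHD hI hU h₃`, assembled field by field from the junction theorems of the rows' owners, over stage 1's cited
record `hR` and modulo the one open row M22 `Fact_algDuality` (BY NAME).  Part 2/2 is `CorCM/Assembly/ModelChain.lean`.
-/
import Summits.HodgeConjecture.CorCM.Model.WeilLineHodge
import Summits.HodgeConjecture.CorCM.Model.ModelFacts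
import Summits.HodgeConjecture.CorCM.Model.PerLConeFacts
import Summits.HodgeConjecture.CorCM.Model.CMDominated
import Summits.HodgeConjecture.CorCM.Model.ExteriorAlgebraFacts
import Literature.AlgebraicGeometry.ComplexMultiplication.ShimuraIsogenyOfRiemann
import HarnessLib

/-!
# COR-CM — `ModelAxioms` of the Picard–CM model universe, row by row (row P7, part 1)

For `U₀ := Model.universeOf hHD hI hU h₃` (`CorCM/Model/Universe.lean`; the model of record `Model.picardCMUniverse hHD hI h₁ h₃`
is `universeOf hHD hI (ballQuotientUniformisedDatum_of h₁) h₃` by `rfl`), `Model.modelAxioms_of_rows` builds the 28-field record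
`U₀.ModelAxioms` consumed by the abstract COR-CM chain (`prop22_surfaceCriterion`, `lemma81_holds`, `pohlmannSpan_of_facts`,
`qw8Sufficiency_of_geometricFacts`), every field filled by the junction theorem of its row of `HOME/BINDER-OWNERS.md` §3:

* model-1, `CorCM/Model/ModelFacts.lean` — M05 `pull_id`, M06 `cup_comm1`, M08 `pull_alg`, M09 `lefschetz11`, M10 `lift`,
  M11 `cup_interchange`, M12 `cmEnd`, M18 `gysin_surface`, M19 `deg_diag`, M21 `conjIsogeny` (modulo Shimura 1998 §6.1 Cor. of
  Thm 2, a tree THEOREM from Riemann's theorem: `ComplexMultiplication.thm2_cor_of_riemann hR`), asides `tr_degree`,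
  `alg_le_hodge`, `cup_alg`;
* model-2, `CorCM/Model/PerLConeFacts.lean` — M01 `pull_comp`, M02 `pull_cup`, M03 `pull_hodge`, M04 `pms_dim`, M07 `H1_rank`,
  M13 `eigenLine`, M14 `alphaLine`, asides `cup2_hodge`, `cmAV`; `CorCM/Model/CMDominated.lean` (filed by b18) — M20
  `cmDominated` over `hR` (Shimura 1998 §6.1 Cor. of Thm 2 / §6.2 Thm 3 = tree theorems `thm2_cor_of_riemann`,
  `thm3_isogenousPower_of_riemann` from Riemann's theorem);
* p2, `CorCM/Model/ExteriorAlgebraFacts.lean` — M15 `kunneth1`, M16 `H4_span`, M17 `weilLine_rank` (from M13 and M07);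
* b12, `CorCM/Model/WeilLineHodge.lean` — aside `weilLine_hodge` (derived for every universe from M03, `cup2_hodge`, M14);
* OPEN, by name — M22 `Fact_algDuality` (hypothesis `h28`).

Nothing is asserted; `hR : DeligneMilne1982_Thm_6_20_full` is stage 1's cited binder B02, displayed in both TOP statements.
-/

noncomputable section

namespace Summit.HodgeConjecture.CorCM

open Literature.NumberTheory.Automorphic.PicardCM
open Literature.AlgebraicGeometry.HodgeTheory
open Literature.AlgebraicGeometry.ComplexMultiplication (thm2_cor_of_riemann)

namespace Model

/-- **`ModelAxioms` of the Picard–CM model universe, row by row** (`HOME/BINDER-OWNERS.md` §3), over stage 1's cited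
record `hR` (Deligne–Milne 1982 Thm 6.20) and modulo the one open row M22 `Fact_algDuality` (hypothesis `h28`, BY NAME).
Field ↦ junction theorem: M05 `pull_id`, M06 `cup_comm1`, M08 `pull_alg`, M09 `lefschetz11`, M10 `lift`, M11
`cup_interchange`, M12 `cmEnd`, M18 `gysin_surface`, M19 `deg_diag`, M21 `conjIsogeny` and the asides `tr_degree`,
`alg_le_hodge`, `cup_alg` — model-1 (`Model/ModelFacts.lean`); M01–M04 `pull_comp`, `pull_cup`, `pull_hodge`, `pms_dim`,
M07 `H1_rank`, M13 `eigenLine`, M14 `alphaLine` and the asides `cup2_hodge`, `cmAV` — model-2 (`Model/PerLConeFacts.lean`);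
M20 `cmDominated` — model-2/b18 (`Model/CMDominated.lean`, over `hR`: Shimura 1998 §6.1 Cor. of Thm 2 and §6.2 Thm 3 are tree
theorems from Riemann's theorem); M15 `kunneth1`, M16 `H4_span`, M17 `weilLine_rank` — p2 (`Model/ExteriorAlgebraFacts.lean`);
aside `weilLine_hodge` — b12 (`Model/WeilLineHodge.lean`, derived for every universe from M03, `cup2_hodge`, M14:
`Universe.weilLine_hodge_of_facts`, `Geometry/WeilLineHodge.lean`). -/
theorem modelAxioms_of_rows (hHD : exists_isReal_hodgeModel) (hI : hodgePQ_independent_of_hodgeModel)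
    (hU : BallQuotientUniformisedDatum) (h₃ : CMAbelianVarietyRealised) (hR : DeligneMilne1982_Thm_6_20_full)
    (h28 : (universeOf hHD hI hU h₃).Fact_algDuality) : (universeOf hHD hI hU h₃).ModelAxioms where
  pull_id := universeOf_pull_id hHD hI hU h₃
  pull_comp := universeOf_fact_pull_comp hHD hI hU h₃
  pull_cup := universeOf_fact_pull_cup hHD hI hU h₃
  pull_hodge := universeOf_fact_pull_hodge hHD hI hU h₃
  cup2_hodge := universeOf_fact_cup2_hodge hHD hI hU h₃
  tr_degree := universeOf_tr_degree hHD hI hU h₃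
  alg_le_hodge := universeOf_alg_le_hodge hHD hI hU h₃
  pull_alg := universeOf_pull_alg hHD hI hU h₃
  cup_alg := universeOf_cup_alg hHD hI hU h₃
  lefschetz11 := universeOf_lefschetz11 hHD hI hU h₃
  cmAV := universeOf_fact_cmAV hHD hI hU h₃
  eigenLine := universeOf_fact_eigenLine hHD hI hU h₃
  alphaLine := universeOf_fact_alphaLine hHD hI hU h₃
  cmDominated := universeOf_fact_cmDominated hHD hI hU h₃ hR
  weilLine_rank := universeOf_fact_weilLine_rank_of hHD hI hU h₃ (universeOf_fact_eigenLine hHD hI hU h₃)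
    (universeOf_fact_H1_rank hHD hI hU h₃)
  weilLine_hodge := universeOf_fact_weilLine_hodge hHD hI hU h₃
  pms_dim := universeOf_pmsDimTwo hHD hI hU h₃
  lift := universeOf_lift hHD hI hU h₃
  cup_comm1 := universeOf_cup_comm1 hHD hI hU h₃
  cup_interchange := universeOf_cup_interchange hHD hI hU h₃
  kunneth1 := universeOf_fact_kunneth1 hHD hI hU h₃
  H1_rank := universeOf_fact_H1_rank hHD hI hU h₃
  H4_span := universeOf_fact_H4_span hHD hI hU h₃
  cmEnd := universeOf_cmEnd hHD hI hU h₃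
  conjIsogeny := universeOf_conjIsogeny hHD hI hU h₃ (thm2_cor_of_riemann hR)
  gysin_surface := universeOf_gysin_surface hHD hI hU h₃
  deg_diag := universeOf_deg_diag hHD hI hU h₃
  algDuality := h28

end Model

end Summit.HodgeConjecture.CorCM

end
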